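import Summits.QuantumAdvantage.AdviceFreeQNC0.WindowFibre
import Summits.QuantumAdvantage.AdviceFreeQNC0.TwistBoundX3Proof
import HarnessLib

/-!
# Cell qa-qnc0, `p = 3` — **`ringWindowBellsSharp3 : RingWindowBellsSharp3`** and rung R-lin3 UNCONDITIONAL
(planner qa-qnc0-p1 g20, ask P-20a(2)–(3); ROUND-19 §3; `exp20/Sketch20x.lean` §2–§3, statements VERBATIM in
`RingLinFormsGlue.lean`)

**`RingWindowBellsSharp3`**: if the bell set `B(x)` is measurable w.r.t. the bits OUTSIDE a window of length `L ≥ L₀(ε)`,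
the strategy `tGuess ⊕ 1_{B(x)}` wins on `≤ (2/3 + ε)·2^{N−1}` odd inputs.  Proof (walk coordinates): the window bits
are not read, so on each fibre of the outside bits the bell set is constant; cut the window into `42` blocks of `ℓ₀` bits;
a fibre with a bell-free block loses a third of it up to `2^{−ℓ₀}` (`sparse_block_le` ⇐ the cell's gap lemma), a fibre
with a bell inside every block has `≥ 42` bells in the window and loses `≥ 1/3` outright (`dense_block_le` ⇐ the fibre path
sum and two 21-bell chains, `WindowFibre.lean`); classify the inputs by the first free block (`firstFree`) and add up.

Corollaries (all UNCONDITIONAL now): `ringJuntaBellsSharp3 : RingJuntaBellsSharp3`, **`ringLinFormsSharp3 :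
RingLinFormsSharp3`** (rung R-lin3: per-cut tables of `K ≤ (log₂N)^C` linear forms of `x` mod 3, arbitrary post-processing,
win `≤ (2/3+ε)·2^{N−1}`), `ringLinFormsLt3 : RingLinFormsLt3`.

WHAT THIS IS NOT: crux 22907 (`RingDenseResidualLt3`, all polylog-degree strategies) untouched; separation NOT moved.
-/

noncomputable section

namespace Summit.QuantumAdvantage.AdviceFreeQNC0

open Finset Literature.Computability.QuantumComplexity Literature.Computability.QuantumComplexity.RingHLF
open Literature.Computability.MetaComplexity

namespace TransferWalk

variable {n : ℕ}

/-! ## Blocks of unread bits, in walk coordinates -/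

/-- `u, u'` agree off the block `[p, p+ℓ)`. -/
def AgreeOff (n p ℓ : ℕ) (u u' : Fin n → Bool) : Prop :=
  ∀ i : Fin n, ¬ (p ≤ i.val ∧ i.val < p + ℓ) → u i = u' i

/-- Glued inputs with different window contents agree off the window. -/
theorem glue3_agreeOff {p ℓ q : ℕ} (a : Fin p → Bool) (v v' : Fin ℓ → Bool) (b : Fin q → Bool) :
    AgreeOff (p + ℓ + q) p ℓ (glue3 a v b) (glue3 a v' b) := by
  intro i hi
  unfold glue3
  by_cases h1 : i.val < p
  · have : i = Fin.castAdd q (Fin.castAdd ℓ ⟨i.val, h1⟩) := Fin.ext rfl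
    rw [this, Fin.append_left, Fin.append_left, Fin.append_left, Fin.append_left]
  · have h2 : p + ℓ ≤ i.val := by omega
    have : i = Fin.natAdd (p + ℓ) ⟨i.val - (p + ℓ), by omega⟩ := Fin.ext (by simp; omega)
    rw [this, Fin.append_right, Fin.append_right]

/-- **Sparse block** (u-level): a selector that does not read the block `[p, p+ℓ)`, a class `P` of inputs determined off
the block on which no cut strictly inside the block fires: `2^ℓ·3·#{P ∧ WIN} ≤ (2·2^ℓ + 2)·#P`. -/
theorem sparse_block_le (n c p ℓ : ℕ) (hpl : p + ℓ ≤ n) (y : Fin (n + 1) → (Fin n → Bool) → Bool)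
    (P : (Fin n → Bool) → Prop) [DecidablePred P]
    (hP : ∀ u u', AgreeOff n p ℓ u u' → P u → P u')
    (hy : ∀ u u', AgreeOff n p ℓ u u' → ∀ g, y g u = y g u')
    (hgap : ∀ u, P u → ∀ g : Fin (n + 1), p < g.val → g.val < p + ℓ → y g u = false) :
    2 ^ ℓ * (3 * (univ.filter fun u : Fin n → Bool => P u ∧ ringWinU c y u = true).card) ≤
      (2 * 2 ^ ℓ + 2) * (univ.filter fun u : Fin n → Bool => P u).card := by
  obtain ⟨q, rfl⟩ : ∃ q, n = p + ℓ + q := ⟨n - (p + ℓ), by omega⟩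
  rw [card_filter_eq_sum_glue3 (fun u => P u ∧ ringWinU c y u = true), card_filter_eq_sum_glue3 (fun u => P u)]
  simp only [Finset.mul_sum]
  refine Finset.sum_le_sum fun a _ => Finset.sum_le_sum fun b _ => ?_
  by_cases hPab : P (glue3 a (fun _ => false) b)
  · have hall : ∀ v, P (glue3 a v b) := fun v => hP _ _ (glue3_agreeOff a _ v b) hPab
    have h1 : (univ.filter fun v : Fin ℓ → Bool => P (glue3 a v b) ∧ ringWinU c y (glue3 a v b) = true) =
        univ.filter fun v : Fin ℓ → Bool => ringWinU c y (glue3 a v b) = true :=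
      filter_congr fun v _ => by simp [hall v]
    have h2 : (univ.filter fun v : Fin ℓ → Bool => P (glue3 a v b)).card = 2 ^ ℓ := by
      rw [Finset.filter_true_of_mem fun v _ => hall v, card_univ, Fintype.card_fun, Fintype.card_bool, Fintype.card_fin]
    rw [h1, h2]
    have h3 := three_mul_card_win_fibre_gap_le c y a b (fun v v' g => hy _ _ (glue3_agreeOff a v v' b) g)
      (fun g hg1 hg2 v => hgap _ (hall v) g hg1 hg2)
    calc 2 ^ ℓ * (3 * (univ.filter fun v : Fin ℓ → Bool => ringWinU c y (glue3 a v b) = true).card)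
        ≤ 2 ^ ℓ * (2 * 2 ^ ℓ + 2) := Nat.mul_le_mul_left _ h3
      _ = (2 * 2 ^ ℓ + 2) * 2 ^ ℓ := by ring
  · have hnone : ∀ v, ¬ P (glue3 a v b) := fun v h => hPab (hP _ _ (glue3_agreeOff a v _ b) h)
    rw [Finset.filter_false_of_mem fun v _ => by simp [hnone v], card_empty]
    simp

/-- **Dense block** (u-level): a selector that does not read the block, a class `P` determined off the block with `≥ 42`
firing cuts in the block: `3·#{P ∧ WIN} ≤ 2·#P`. -/
theorem dense_block_le (n p ℓ : ℕ) (hpl : p + ℓ ≤ n) (y : Fin (n + 1) → (Fin n → Bool) → Bool)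
    (P : (Fin n → Bool) → Prop) [DecidablePred P]
    (hP : ∀ u u', AgreeOff n p ℓ u u' → P u → P u')
    (hy : ∀ u u', AgreeOff n p ℓ u u' → ∀ g, y g u = y g u')
    (hdense : ∀ u, P u → 42 ≤ (univ.filter fun g : Fin (n + 1) => p ≤ g.val ∧ g.val < p + ℓ ∧ y g u = true).card) :
    3 * ((univ.filter fun u : Fin n → Bool => P u ∧ ringWinU (n + 2) y u = true).card : ℝ) ≤
      2 * ((univ.filter fun u : Fin n → Bool => P u).card : ℝ) := by
  obtain ⟨q, rfl⟩ : ∃ q, n = p + ℓ + q := ⟨n - (p + ℓ), by omega⟩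
  rw [card_filter_eq_sum_glue3 (fun u => P u ∧ ringWinU (p + ℓ + q + 2) y u = true),
    card_filter_eq_sum_glue3 (fun u => P u)]
  push_cast
  simp only [Finset.mul_sum]
  refine Finset.sum_le_sum fun a _ => Finset.sum_le_sum fun b _ => ?_
  by_cases hPab : P (glue3 a (fun _ => false) b)
  · have hall : ∀ v, P (glue3 a v b) := fun v => hP _ _ (glue3_agreeOff a _ v b) hPab
    have h1 : (univ.filter fun v : Fin ℓ → Bool => P (glue3 a v b) ∧ ringWinU (p + ℓ + q + 2) y (glue3 a v b) = true) =
        univ.filter fun v : Fin ℓ → Bool => ringWinU (p + ℓ + q + 2) y (glue3 a v b) = true :=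
      filter_congr fun v _ => by simp [hall v]
    have h2 : (univ.filter fun v : Fin ℓ → Bool => P (glue3 a v b)).card = 2 ^ ℓ := by
      rw [Finset.filter_true_of_mem fun v _ => hall v, card_univ, Fintype.card_fun, Fintype.card_bool, Fintype.card_fin]
    rw [h1, h2]
    push_cast
    exact three_mul_card_win_fibre_dense_le y a b (fun v v' g => hy _ _ (glue3_agreeOff a v v' b) g)
      (hdense _ hPab)
  · have hnone : ∀ v, ¬ P (glue3 a v b) := fun v h => hPab (hP _ _ (glue3_agreeOff a v _ b) h)
    rw [Finset.filter_false_of_mem fun v _ => by simp [hnone v], card_empty]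
    simp

/-! ## The classification by the first free block -/

section Classify

variable (y : Fin (n + 1) → (Fin n → Bool) → Bool) (p ℓ₀ : ℕ)

/-- Block `t` of the window is FREE at `u`: no cut strictly inside `(p + tℓ₀, p + tℓ₀ + ℓ₀)` fires. -/
def Free (u : Fin n → Bool) (t : Fin 42) : Prop :=
  ∀ g : Fin (n + 1), p + t.val * ℓ₀ < g.val → g.val < p + t.val * ℓ₀ + ℓ₀ → y g u = false

/-- The first free block, if any. -/
def firstFree (u : Fin n → Bool) : Option (Fin 42) :=
  open scoped Classical in
  if h : (univ.filter fun t : Fin 42 => Free y p ℓ₀ u t).Nonempty then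
    some ((univ.filter fun t : Fin 42 => Free y p ℓ₀ u t).min' h) else none

/-- `firstFree = some t` ⇒ block `t` is free. -/
theorem free_of_firstFree_eq_some {u : Fin n → Bool} {t : Fin 42} (h : firstFree y p ℓ₀ u = some t) : Free y p ℓ₀ u t := by
  classical
  unfold firstFree at h
  split_ifs at h with hne
  have hmem := (univ.filter fun t : Fin 42 => Free y p ℓ₀ u t).min'_mem hne
  rw [Option.some_inj.1 h] at hmem
  simpa using hmem

/-- `firstFree = none` ⇒ no block is free. -/
theorem not_free_of_firstFree_eq_none {u : Fin n → Bool} (h : firstFree y p ℓ₀ u = none) (t : Fin 42) :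
    ¬ Free y p ℓ₀ u t := by
  classical
  unfold firstFree at h
  split_ifs at h with hne
  intro ht
  exact hne ⟨t, by simpa using ht⟩

/-- `firstFree` only depends on the selector values. -/
theorem firstFree_congr {u u' : Fin n → Bool} (h : ∀ g, y g u = y g u') : firstFree y p ℓ₀ u = firstFree y p ℓ₀ u' := by
  classical
  have hF : ∀ t, Free y p ℓ₀ u t ↔ Free y p ℓ₀ u' t := fun t => by unfold Free; simp only [h]
  unfold firstFree
  have hs : (univ.filter fun t : Fin 42 => Free y p ℓ₀ u t) = univ.filter fun t : Fin 42 => Free y p ℓ₀ u' t :=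
    filter_congr fun t _ => hF t
  simp only [hs]

/-- No free block ⇒ `≥ 42` firing cuts inside `[p, p + 42ℓ₀)`. -/
theorem card_ge_of_no_free {M : ℕ} (hM : 42 * ℓ₀ ≤ M) (u : Fin n → Bool)
    (h : ∀ t : Fin 42, ¬ Free y p ℓ₀ u t) :
    42 ≤ (univ.filter fun g : Fin (n + 1) => p ≤ g.val ∧ g.val < p + M ∧ y g u = true).card := by
  classical
  have hex : ∀ t : Fin 42, ∃ g : Fin (n + 1), p + t.val * ℓ₀ < g.val ∧ g.val < p + t.val * ℓ₀ + ℓ₀ ∧ y g u = true := by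
    intro t
    have ht := h t
    unfold Free at ht
    push Not at ht
    obtain ⟨g, h1, h2, h3⟩ := ht
    exact ⟨g, h1, h2, by simpa using h3⟩
  choose f hf using hex
  have hinj : Function.Injective f := by
    intro t t' htt
    have h1 := hf t
    have h2 := hf t'
    rw [htt] at h1
    by_contra hne
    rcases Nat.lt_or_gt_of_ne (fun e => hne (Fin.ext e)) with hlt | hlt
    · have : (t.val + 1) * ℓ₀ ≤ t'.val * ℓ₀ := Nat.mul_le_mul_right _ hlt
      rw [Nat.add_mul, one_mul] at this
      omega
    · have : (t'.val + 1) * ℓ₀ ≤ t.val * ℓ₀ := Nat.mul_le_mul_right _ hlt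
      rw [Nat.add_mul, one_mul] at this
      omega
  have hsub : Finset.univ.image f ⊆ univ.filter fun g : Fin (n + 1) => p ≤ g.val ∧ g.val < p + M ∧ y g u = true := by
    intro g hg
    rw [Finset.mem_image] at hg
    obtain ⟨t, _, rfl⟩ := hg
    obtain ⟨h1, h2, h3⟩ := hf t
    have ht : (t.val + 1) * ℓ₀ ≤ 42 * ℓ₀ := Nat.mul_le_mul_right _ (by omega)
    rw [Nat.add_mul, one_mul] at ht
    simp only [mem_filter, mem_univ, true_and]
    exact ⟨by omega, by omega, h3⟩
  calc 42 = (Finset.univ.image f).card := by rw [Finset.card_image_of_injective _ hinj]; simp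
    _ ≤ _ := Finset.card_le_card hsub

end Classify

/-- **The window theorem in walk coordinates**: a selector not reading the `M ≥ 42ℓ₀` bits `[p, p+M)` wins on at most
`(2/3)(1 + 2^{−ℓ₀})·2ⁿ` inputs: `2^{ℓ₀}·3·#WIN ≤ (2·2^{ℓ₀} + 2)·2ⁿ` (any `ℓ₀`, also `0`). -/
theorem window_le (n p M ℓ₀ : ℕ) (hpM : p + M ≤ n) (hM : 42 * ℓ₀ ≤ M)
    (y : Fin (n + 1) → (Fin n → Bool) → Bool) (hy : ∀ u u', AgreeOff n p M u u' → ∀ g, y g u = y g u') :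
    (2 : ℝ) ^ ℓ₀ * (3 * ((univ.filter fun u : Fin n → Bool => ringWinU (n + 2) y u = true).card : ℝ)) ≤
      (2 * (2 : ℝ) ^ ℓ₀ + 2) * (2 : ℝ) ^ n := by
  classical
  set κ := firstFree y p ℓ₀ with hκ
  -- `κ` is determined off the window, a fortiori off every block
  have hκ_off : ∀ u u', (∀ g, y g u = y g u') → κ u = κ u' := fun u u' h => firstFree_congr y p ℓ₀ h
  have hblock_off : ∀ (t : Fin 42) (u u' : Fin n → Bool), AgreeOff n (p + t.val * ℓ₀) ℓ₀ u u' → AgreeOff n p M u u' := by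
    intro t u u' h i hi
    have ht : (t.val + 1) * ℓ₀ ≤ 42 * ℓ₀ := Nat.mul_le_mul_right _ (by omega)
    rw [Nat.add_mul, one_mul] at ht
    exact h i (by omega)
  -- fibrewise decomposition of both counts along `κ`
  set W := (univ.filter fun u : Fin n → Bool => ringWinU (n + 2) y u = true) with hW
  have hWsum : (W.card : ℝ) = ∑ k : Option (Fin 42), ((W.filter fun u => κ u = k).card : ℝ) := by
    rw [Finset.card_eq_sum_card_fiberwise (f := κ) (t := univ) (fun _ _ => mem_univ _)]; push_cast; rfl
  have hUsum : ((2 : ℝ) ^ n) = ∑ k : Option (Fin 42), ((univ.filter fun u : Fin n → Bool => κ u = k).card : ℝ) := by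
    have := Finset.card_eq_sum_card_fiberwise (f := κ) (s := (univ : Finset (Fin n → Bool))) (t := univ)
      (fun _ _ => mem_univ _)
    rw [card_univ, Fintype.card_fun, Fintype.card_bool, Fintype.card_fin] at this
    exact_mod_cast this
  have hWk : ∀ k : Option (Fin 42), (W.filter fun u => κ u = k) =
      univ.filter fun u : Fin n → Bool => κ u = k ∧ ringWinU (n + 2) y u = true := by
    intro k; ext u; simp [hW, and_comm]
  -- per class
  have hclass : ∀ k : Option (Fin 42), (2 : ℝ) ^ ℓ₀ * (3 * ((W.filter fun u => κ u = k).card : ℝ)) ≤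
      (2 * (2 : ℝ) ^ ℓ₀ + 2) * ((univ.filter fun u : Fin n → Bool => κ u = k).card : ℝ) := by
    intro k
    rw [hWk k]
    cases k with
    | none =>
      -- dense class
      have hd := dense_block_le n p M hpM y (fun u => κ u = none)
        (fun u u' h hu => (hκ_off u u' (hy u u' h)).symm.trans hu)
        hy (fun u hu => card_ge_of_no_free y p ℓ₀ hM u (not_free_of_firstFree_eq_none y p ℓ₀ hu))
      have h0 : (0 : ℝ) ≤ ((univ.filter fun u : Fin n → Bool => κ u = none).card : ℝ) := by positivity
      have h1 : (1 : ℝ) ≤ (2 : ℝ) ^ ℓ₀ := one_le_pow₀ (by norm_num)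
      nlinarith
    | some t =>
      -- sparse class: block `t` is free
      have hs := sparse_block_le n (n + 2) (p + t.val * ℓ₀) ℓ₀ (by
          have ht : (t.val + 1) * ℓ₀ ≤ 42 * ℓ₀ := Nat.mul_le_mul_right _ (by omega)
          rw [Nat.add_mul, one_mul] at ht; omega)
        y (fun u => κ u = some t)
        (fun u u' h hu => (hκ_off u u' (hy u u' (hblock_off t u u' h))).symm.trans hu)
        (fun u u' h => hy u u' (hblock_off t u u' h))
        (fun u hu g hg1 hg2 => free_of_firstFree_eq_some y p ℓ₀ hu g hg1 hg2)
      have := (Nat.cast_le (α := ℝ)).2 hs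
      push_cast at this
      linarith
  rw [hWsum, hUsum, Finset.mul_sum, Finset.mul_sum, Finset.mul_sum]
  exact Finset.sum_le_sum fun k _ => by have := hclass k; linarith

end TransferWalk

/-! ## Back to the ring: `RingWindowBellsSharp3` and rung R-lin3 -/

namespace BondTwist3

open TransferWalk

/-- The chart `xOfU` outside the x-window `[a, a+L)` does not read the u-window `[a, a+L-1)`. -/
theorem xOfU_agree {n a L : ℕ} {u u' : Fin n → Bool} (h : TransferWalk.AgreeOff n a (L - 1) u u')
    (j : Fin (n + 1)) (hj : j.val < a ∨ a + L ≤ j.val) : xOfU u j = xOfU u' j := by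
  have hext : ∀ i : ℕ, (i < a ∨ a + L - 1 ≤ i) → uExt u i = uExt u' i := by
    intro i hi
    unfold uExt
    split_ifs with hin
    · exact h ⟨i, hin⟩ (by simp only; omega)
    · rfl
  unfold xOfU
  rw [hext j.val (by omega)]
  by_cases hj0 : j.val = 0
  · simp [hj0]
  · rw [if_neg hj0, if_neg hj0, hext (j.val - 1) (by omega)]

/-- **`ringWindowBellsSharp3 : RingWindowBellsSharp3` — PROVED.** -/
theorem ringWindowBellsSharp3 : RingWindowBellsSharp3 := by
  classical
  intro ε hε
  -- `ℓ₀` with `2^{-ℓ₀} ≤ ε`, window length `L₀ = 42ℓ₀ + 3`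
  obtain ⟨ℓ₀, hℓ₀⟩ : ∃ ℓ₀ : ℕ, 1 / ε ≤ (2 : ℝ) ^ ℓ₀ := by
    obtain ⟨k, hk⟩ := pow_unbounded_of_one_lt (1 / ε) (by norm_num : (1 : ℝ) < 2)
    exact ⟨k, hk.le⟩
  refine ⟨42 * ℓ₀ + 3, fun N a L hL haL B hB => ?_⟩
  have hεpow : (1 : ℝ) ≤ ε * (2 : ℝ) ^ ℓ₀ := by
    have := hℓ₀; rw [div_le_iff₀ hε] at this; linarith
  obtain ⟨n, rfl⟩ : ∃ n, N = n + 1 := ⟨N - 1, by omega⟩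
  have hn : 2 ≤ n := by omega
  rw [Nat.add_sub_cancel]
  -- transport to walk coordinates
  set z : (Fin (n + 1) → Bool) → (Fin (n + 1) → Bool) := fun x k => xor (tGuess x k) (decide (k ∈ B x)) with hz
  set y : Fin (n + 1) → (Fin n → Bool) → Bool := fun g u => decide (g ∈ B (xOfU u)) with hydef
  have hy' : (fun (g : Fin (n + 1)) (u : Fin n → Bool) => xor (z (xOfU u) g) (tGuess (xOfU u) g)) = y := by
    funext g u
    simp only [hz, hydef]
    generalize tGuess (xOfU u) g = t
    generalize decide (g ∈ B (xOfU u)) = d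
    cases t <;> cases d <;> rfl
  have hsub : (univ.filter fun x : Fin (n + 1) → Bool => OddZeros x ∧ Rel x (z x)) ⊆
      univ.filter fun x : Fin (n + 1) → Bool =>
        (univ.filter fun j : Fin (n + 1) => x j = false).card % 2 = 1 ∧ ringWinU (n + 2) y (uVec x) = true := by
    intro x hx
    rw [mem_filter] at hx ⊢
    refine ⟨mem_univ _, hx.2.1, ?_⟩
    have h := (rel_iff_ringWinU hn x hx.2.1 z).1 hx.2.2
    rw [hy'] at h
    exact h
  have h1 := Finset.card_le_card hsub
  have h2 := card_odd_filter_le hn (fun u : Fin n → Bool => ringWinU (n + 2) y u = true)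
  -- the selector does not read the u-window `[a, a + (L-1))`
  have hyread : ∀ u u', TransferWalk.AgreeOff n a (L - 1) u u' → ∀ g, y g u = y g u' := by
    intro u u' h g
    have hBx : B (xOfU u) = B (xOfU u') := hB _ _ fun i hi => xOfU_agree h i hi
    simp only [hydef, hBx]
  have hwin := window_le n a (L - 1) ℓ₀ (by omega) (by omega) y hyread
  -- arithmetic
  have h3 : ((univ.filter fun x : Fin (n + 1) → Bool => OddZeros x ∧ Rel x (z x)).card : ℝ) ≤
      ((univ.filter fun u : Fin n → Bool => ringWinU (n + 2) y u = true).card : ℝ) := by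
    exact_mod_cast h1.trans h2
  have h2n : (0 : ℝ) < (2 : ℝ) ^ n := by positivity
  have h2l : (0 : ℝ) < (2 : ℝ) ^ ℓ₀ := by positivity
  -- `2^{ℓ₀}·3·W ≤ (2·2^{ℓ₀} + 2)·2ⁿ` ⇒ `W ≤ (2/3 + ε)·2ⁿ`
  have key : (2 : ℝ) ^ ℓ₀ * (3 * ((univ.filter fun u : Fin n → Bool => ringWinU (n + 2) y u = true).card : ℝ)) ≤
      (2 : ℝ) ^ ℓ₀ * (3 * ((2 / 3 + ε) * (2 : ℝ) ^ n)) := by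
    refine hwin.trans ?_
    nlinarith
  have := le_of_mul_le_mul_left key h2l
  linarith

/-- **`RingJuntaBellsSharp3` — PROVED** (pigeonhole glue `ringJuntaBellsSharp3_of_window`). -/
theorem ringJuntaBellsSharp3 : RingJuntaBellsSharp3 := ringJuntaBellsSharp3_of_window ringWindowBellsSharp3

/-- **RUNG R-lin3 `RingLinFormsSharp3` — PROVED UNCONDITIONALLY**: bells = per-cut tables of `K ≤ (log₂ N)^C` linear forms
of `x` mod 3 win on `≤ (2/3 + ε)·2^{N−1}` odd inputs (error term `twistBoundX3`, main term `ringJuntaBellsSharp3`, the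
generic regularise–expand inequality `LinForms.card_le_junta_add_twist`). -/
theorem ringLinFormsSharp3 : RingLinFormsSharp3 := ringLinFormsSharp3_of_junta ringJuntaBellsSharp3

/-- The route-facing `θ < 1` form of rung R-lin3 — PROVED. -/
theorem ringLinFormsLt3 : RingLinFormsLt3 := ringLinFormsLt3_of_sharp ringLinFormsSharp3

end BondTwist3

end Summit.QuantumAdvantage.AdviceFreeQNC0

end
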